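import Mathlib
import HarnessLib

/-!
# Mizutani's conjecture `m(e) = 2p^e − 1` — the DIGIT LEMMA, part L (levels)

Cell topic `Summits/ResolutionOfSingularities/KangarooAtlas` (pub-rosobs); namespace
`Summit.ResolutionOfSingularities.KangarooAtlas.Mizutani.DigitLemma`.  Kernel certificate of the
DIGIT LEMMA of the in-house note MIZUTANI-PROOF-g59 §4 (AI-written, AI-audited; *AI review is weaker
than expert review*; not a resolution theorem), written by the invariant-census lane (gen 61, scratch file
`lean/invcensus-g61/MizutaniDigitLemma.lean`, 881 lines, rc 0) and landed here in three parts by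
encloser-1 (statement unchanged; namespace moved under the cell topic; docstrings tagged).

STATEMENT (part N, `MizutaniDigitLemma`): for `N : Fin s → ℕ` with `N i < q := p^e`, `Σ N i ≥ q` and
`Σ ⌊N i / p⌋ ≤ p^(e−1) − 1` ("genuine"), every `1 ≤ m ≤ q − 1` admits two distinct `T ≠ T'` digitwise
dominated by `N` coordinatewise with `|T| = |T'| = m`; cumulatively `#{T ≤_d N : |T| ≤ i} ≥ 2i + 1` for
`i ≤ q − 1` — the combinatorial content of `σ_i(t^N) ≥ 2i+1` (§1.4 MONOMIALS + §4).  `p ≥ 2` arbitrary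
(primality enters only through Lucas in part N).

THIS PART (levels; the note's KEY / COV / SYM / UNIQ and the level theorem): capacities `D : ℕ → ℕ`
(`D_k = Σ_i d_{ik}`), `M D p k = Σ_{l<k} D_l p^l`, the floor `F`, representations `Rep` of `m` as
`Σ j_k p^k` with `j_k ≤ D_k`; `key` (`p^k ≤ M_k`), `cov` (every `x ≤ M_k` is represented), `sym`
(complements), `uniq` (a representation with `j_0 = 0` has a companion), `level_main` (every
`1 ≤ m ≤ M_e − 1` has two representations or one with `1 ≤ j_0 ≤ D_0 − 1`).

References: [Mizutani1973HironakaGroupSchemes] (Remark 2.10: the conjecture; in-house proof §4).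
-/

open Finset

namespace Summit.ResolutionOfSingularities.KangarooAtlas.Mizutani.DigitLemma

variable {D : ℕ → ℕ} {p e : ℕ}

/-- weighted partial sum of the level capacities: `M D p k = ∑_{l<k} D l * p^l`. [cite: Mizutani1973HironakaGroupSchemes, Remark 2.10 (in-house proof MIZUTANI-PROOF-g59 §4, Digit Lemma)] -/
def M (D : ℕ → ℕ) (p k : ℕ) : ℕ := ∑ l ∈ range k, D l * p ^ l

/-- the "floor" `∑_{l<e-1} D (l+1) * p^l`. [cite: Mizutani1973HironakaGroupSchemes, Remark 2.10 (in-house proof MIZUTANI-PROOF-g59 §4, Digit Lemma)] -/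
def F (D : ℕ → ℕ) (p e : ℕ) : ℕ := ∑ l ∈ range (e - 1), D (l + 1) * p ^ l

/-- `j` represents `x` below level `k` with capacities `D`. [cite: Mizutani1973HironakaGroupSchemes, Remark 2.10 (in-house proof MIZUTANI-PROOF-g59 §4, Digit Lemma)] -/
structure Rep (D : ℕ → ℕ) (p k : ℕ) (j : ℕ → ℕ) (x : ℕ) : Prop where
  le : ∀ l, j l ≤ D l
  zero : ∀ l, k ≤ l → j l = 0
  sum : ∑ l ∈ range k, j l * p ^ l = x

/-- Helper step `M_zero` of the Digit Lemma certificate (MIZUTANI-PROOF-g59 §4). [folklore] -/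
lemma M_zero : M D p 0 = 0 := by simp [M]

/-- Helper step `M_succ` of the Digit Lemma certificate (MIZUTANI-PROOF-g59 §4). [folklore] -/
lemma M_succ (k : ℕ) : M D p (k + 1) = M D p k + D k * p ^ k := by
  simp [M, sum_range_succ]

/-- splitting `M e = M k + p^k * S` with `S = ∑_{x < e-k} D (k+x) p^x`. [folklore] -/
lemma M_split {k : ℕ} (hk : k ≤ e) :
    M D p e = M D p k + p ^ k * ∑ x ∈ range (e - k), D (k + x) * p ^ x := by
  unfold M
  have : e = k + (e - k) := by omega
  conv_lhs => rw [this]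
  rw [sum_range_add, mul_sum]
  congr 1
  apply sum_congr rfl
  intro x _
  rw [pow_add]; ring

/-- the floor dominates `p^(k-1) * S`. [folklore] -/
lemma F_ge {k : ℕ} (hk1 : 1 ≤ k) (hk : k ≤ e) :
    p ^ (k - 1) * ∑ x ∈ range (e - k), D (k + x) * p ^ x ≤ F D p e := by
  unfold F
  have hsplit : e - 1 = (k - 1) + (e - k) := by omega
  rw [hsplit, sum_range_add, mul_sum]
  calc ∑ i ∈ range (e - k), p ^ (k - 1) * (D (k + i) * p ^ i)
      = ∑ x ∈ range (e - k), D (k - 1 + x + 1) * p ^ (k - 1 + x) := by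
        apply sum_congr rfl
        intro x _
        have : k - 1 + x + 1 = k + x := by omega
        rw [this, pow_add]; ring
    _ ≤ _ := Nat.le_add_left _ _

/-- KEY: `p^k ≤ M k` for `1 ≤ k < e`, from `p^e ≤ M e` and `F ≤ p^(e-1) - 1`. [cite: Mizutani1973HironakaGroupSchemes, Remark 2.10 (in-house proof MIZUTANI-PROOF-g59 §4, Digit Lemma)] -/
theorem key (hp : 2 ≤ p) (hW : p ^ e ≤ M D p e) (hF : F D p e ≤ p ^ (e - 1) - 1)
    {k : ℕ} (hk1 : 1 ≤ k) (hke : k < e) : p ^ k ≤ M D p k := by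
  by_contra hlt
  push Not at hlt
  set S := ∑ x ∈ range (e - k), D (k + x) * p ^ x with hS
  have hsplit := M_split (D := D) (p := p) (k := k) (le_of_lt hke)
  have hpos : 0 < p := by omega
  have hpe : p ^ e = p ^ k * p ^ (e - k) := by rw [← pow_add]; congr 1; omega
  -- S ≥ p^(e-k)
  have hSge : p ^ (e - k) ≤ S := by
    by_contra hS'
    push Not at hS'
    have h1 : S + 1 ≤ p ^ (e - k) := hS'
    have h2 : p ^ k * (S + 1) ≤ p ^ k * p ^ (e - k) := Nat.mul_le_mul_left _ h1
    have h3 : M D p e < p ^ e := by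
      rw [hsplit, hpe]
      have : M D p k + 1 ≤ p ^ k := hlt
      nlinarith
    omega
  -- then F ≥ p^(k-1) * p^(e-k) = p^(e-1)
  have hF' : p ^ (e - 1) ≤ F D p e := by
    calc p ^ (e - 1) = p ^ (k - 1) * p ^ (e - k) := by rw [← pow_add]; congr 1; omega
      _ ≤ p ^ (k - 1) * S := Nat.mul_le_mul_left _ hSge
      _ ≤ F D p e := F_ge hk1 (le_of_lt hke)
  have : 1 ≤ p ^ (e - 1) := Nat.one_le_pow _ _ hpos
  omega

/-- COV: every `x ≤ M k` (`k ≤ e`) is represented below level `k`. [cite: Mizutani1973HironakaGroupSchemes, Remark 2.10 (in-house proof MIZUTANI-PROOF-g59 §4, Digit Lemma)] -/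
theorem cov (hp : 2 ≤ p) (hW : p ^ e ≤ M D p e) (hF : F D p e ≤ p ^ (e - 1) - 1) :
    ∀ k, k ≤ e → ∀ x, x ≤ M D p k → ∃ j, Rep D p k j x := by
  intro k
  induction k with
  | zero =>
    intro _ x hx
    refine ⟨fun _ => 0, ?_⟩
    have : x = 0 := by simpa [M_zero] using hx
    subst this
    exact ⟨fun l => Nat.zero_le _, fun _ _ => rfl, by simp⟩
  | succ k ih =>
    intro hke x hx
    have hpos : 0 < p := by omega
    have hpk : 0 < p ^ k := pow_pos hpos k
    -- overlap: M k + 1 ≥ p^k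
    have hov : p ^ k ≤ M D p k + 1 := by
      rcases Nat.eq_zero_or_pos k with h0 | hk1
      · subst h0; simp [M_zero]
      · have := key hp hW hF hk1 (by omega : k < e); omega
    set c := min (D k) (x / p ^ k) with hc
    have hcD : c ≤ D k := min_le_left _ _
    have hcx : c * p ^ k ≤ x := by
      calc c * p ^ k ≤ (x / p ^ k) * p ^ k := Nat.mul_le_mul_right _ (min_le_right _ _)
        _ ≤ x := Nat.div_mul_le_self _ _
    have hrest : x - c * p ^ k ≤ M D p k := by
      rcases le_total (D k) (x / p ^ k) with h | h
      · have : c = D k := by rw [hc, min_eq_left h]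
        rw [this]
        have := M_succ (D := D) (p := p) k
        omega
      · have hc' : c = x / p ^ k := by rw [hc, min_eq_right h]
        rw [hc']
        have h1 : x < x / p ^ k * p ^ k + p ^ k := Nat.lt_div_mul_add hpk
        omega
    obtain ⟨j', hj'⟩ := ih (by omega) (x - c * p ^ k) hrest
    refine ⟨fun l => if l = k then c else j' l, ?_, ?_, ?_⟩
    · intro l
      by_cases hl : l = k
      · subst hl; simp [hcD]
      · simp [hl, hj'.le l]
    · intro l hl
      have hl' : l ≠ k := by omega
      simp [hl', hj'.zero l (by omega)]
    · rw [sum_range_succ]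
      simp only [if_true]
      have : ∑ l ∈ range k, (if l = k then c else j' l) * p ^ l = ∑ l ∈ range k, j' l * p ^ l := by
        apply sum_congr rfl
        intro l hl
        have : l ≠ k := by simp at hl; omega
        simp [this]
      rw [this, hj'.sum]
      omega


/-- SYM: the complement `l ↦ D l - j l` (below `k`) represents `M k - x`. [cite: Mizutani1973HironakaGroupSchemes, Remark 2.10 (in-house proof MIZUTANI-PROOF-g59 §4, Digit Lemma)] -/
def compl (D : ℕ → ℕ) (k : ℕ) (j : ℕ → ℕ) : ℕ → ℕ := fun l => if l < k then D l - j l else 0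

/-- Helper step `sum_le_M` of the Digit Lemma certificate (MIZUTANI-PROOF-g59 §4). [folklore] -/
lemma sum_le_M {k : ℕ} {j : ℕ → ℕ} {x : ℕ} (h : Rep D p k j x) : x ≤ M D p k := by
  rw [← h.sum]; unfold M
  apply sum_le_sum
  intro l _
  exact Nat.mul_le_mul_right _ (h.le l)

/-- Helper step `sym` of the Digit Lemma certificate (MIZUTANI-PROOF-g59 §4). [cite: Mizutani1973HironakaGroupSchemes, Remark 2.10 (in-house proof MIZUTANI-PROOF-g59 §4, Digit Lemma)] -/
theorem sym {k : ℕ} {j : ℕ → ℕ} {x : ℕ} (h : Rep D p k j x) :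
    Rep D p k (compl D k j) (M D p k - x) := by
  refine ⟨?_, ?_, ?_⟩
  · intro l; unfold compl; split_ifs <;> omega
  · intro l hl; unfold compl; simp [Nat.not_lt.mpr hl]
  · have hadd : ∑ l ∈ range k, compl D k j l * p ^ l + ∑ l ∈ range k, j l * p ^ l = M D p k := by
      rw [← sum_add_distrib]; unfold M
      apply sum_congr rfl
      intro l hl
      have hl' : l < k := by simpa using hl
      have := h.le l
      unfold compl; simp [hl']
      rw [← add_mul, Nat.sub_add_cancel this]
    rw [h.sum] at hadd
    omega

/-- Helper step `compl_compl` of the Digit Lemma certificate (MIZUTANI-PROOF-g59 §4). [folklore] -/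
lemma compl_compl {k : ℕ} {j : ℕ → ℕ} {x : ℕ} (h : Rep D p k j x) :
    compl D k (compl D k j) = j := by
  funext l
  unfold compl
  by_cases hl : l < k
  · have := h.le l; simp [hl]; omega
  · simp [hl, h.zero l (by omega)]

/-- Helper step `compl_injective` of the Digit Lemma certificate (MIZUTANI-PROOF-g59 §4). [folklore] -/
lemma compl_injective {k : ℕ} {j j' : ℕ → ℕ} {x x' : ℕ} (h : Rep D p k j x) (h' : Rep D p k j' x')
    (hc : compl D k j = compl D k j') : j = j' := by
  rw [← compl_compl h, ← compl_compl h', hc]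

/-- UNIQ: a representation of `x ≥ 1` with `j 0 = 0` has a companion `j' ≠ j`. [cite: Mizutani1973HironakaGroupSchemes, Remark 2.10 (in-house proof MIZUTANI-PROOF-g59 §4, Digit Lemma)] -/
theorem uniq (hp : 2 ≤ p) (hW : p ^ e ≤ M D p e) (hF : F D p e ≤ p ^ (e - 1) - 1)
    {k : ℕ} (hk : k ≤ e) {j : ℕ → ℕ} {x : ℕ} (h : Rep D p k j x) (hx : 1 ≤ x) (hj0 : j 0 = 0) :
    ∃ j', Rep D p k j' x ∧ j' ≠ j := by
  classical
  -- some level carries a nonzero entry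
  have hex : ∃ l, j l ≠ 0 := by
    by_contra hnone
    push Not at hnone
    have : ∑ l ∈ range k, j l * p ^ l = 0 := by
      apply sum_eq_zero; intro l _; simp [hnone l]
    rw [h.sum] at this; omega
  let ks := Nat.find hex
  have hks : j ks ≠ 0 := Nat.find_spec hex
  have hmin : ∀ l, l < ks → j l = 0 := fun l hl => by
    have := Nat.find_min hex hl; simpa using this
  have hks1 : 1 ≤ ks := by
    by_contra h0; push Not at h0
    have : ks = 0 := by omega
    exact hks (by rw [this]; exact hj0)
  have hksk : ks < k := by
    by_contra hc; push Not at hc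
    exact hks (h.zero ks hc)
  have hkse : ks < e := by omega
  -- p^ks ≤ M ks, so p^ks is represented below ks
  have hkey := key hp hW hF hks1 hkse
  obtain ⟨i, hi⟩ := cov hp hW hF ks (by omega) (p ^ ks) hkey
  refine ⟨fun l => if l < ks then i l else if l = ks then j ks - 1 else j l, ⟨?_, ?_, ?_⟩, ?_⟩
  · intro l
    by_cases h1 : l < ks
    · simp [h1, hi.le l]
    · by_cases h2 : l = ks
      · subst h2; simp; have := h.le ks; omega
      · simp [h1, h2, h.le l]
  · intro l hl
    have h1 : ¬ l < ks := by omega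
    have h2 : l ≠ ks := by omega
    simp [h1, h2, h.zero l hl]
  · -- termwise: j' l p^l + [l = ks] p^ks = j l p^l + [l < ks] i l p^l
    have hpt : ∀ l, (if l < ks then i l else if l = ks then j ks - 1 else j l) * p ^ l
        + (if l = ks then p ^ ks else 0) = j l * p ^ l + (if l < ks then i l * p ^ l else 0) := by
      intro l
      by_cases h1 : l < ks
      · have h2 : l ≠ ks := by omega
        simp [h1, h2, hmin l h1]
      · by_cases h2 : l = ks
        · subst h2; simp
          obtain ⟨a, ha⟩ : ∃ a, j ks = a + 1 := ⟨j ks - 1, by omega⟩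
          rw [ha, Nat.add_sub_cancel]; ring
        · simp [h1, h2]
    have hsum := sum_congr (rfl : range k = range k) (fun l (_ : l ∈ range k) => hpt l)
    rw [sum_add_distrib, sum_add_distrib, h.sum] at hsum
    rw [sum_ite_eq' (range k) ks (fun _ => p ^ ks)] at hsum
    have hmem : ks ∈ range k := by simpa using hksk
    rw [if_pos hmem] at hsum
    have hI : ∑ l ∈ range k, (if l < ks then i l * p ^ l else 0) = p ^ ks := by
      rw [← sum_filter]
      have : (range k).filter (fun l => l < ks) = range ks := by
        ext l; simp; omega
      rw [this, hi.sum]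
    rw [hI] at hsum
    omega
  · intro heq
    have := congrFun heq ks
    simp at this
    omega

/-- MAIN LEVEL THEOREM: every `1 ≤ m ≤ M e - 1` has either two distinct representations below
level `e`, or one whose level-0 entry lies in `[1, D 0 - 1]`. [cite: Mizutani1973HironakaGroupSchemes, Remark 2.10 (in-house proof MIZUTANI-PROOF-g59 §4, Digit Lemma)] -/
theorem level_main (hp : 2 ≤ p) (hW : p ^ e ≤ M D p e) (hF : F D p e ≤ p ^ (e - 1) - 1)
    {m : ℕ} (hm1 : 1 ≤ m) (hm2 : m + 1 ≤ M D p e) :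
    ∃ j, Rep D p e j m ∧ ((∃ j', Rep D p e j' m ∧ j' ≠ j) ∨ (1 ≤ j 0 ∧ j 0 + 1 ≤ D 0)) := by
  obtain ⟨j, hj⟩ := cov hp hW hF e le_rfl m (by omega)
  by_cases h0 : j 0 = 0
  · obtain ⟨j', hj', hne⟩ := uniq hp hW hF le_rfl hj hm1 h0
    exact ⟨j, hj, Or.inl ⟨j', hj', hne⟩⟩
  · by_cases hD : j 0 = D 0
    · -- pass to the complement, apply UNIQ there, come back
      have hc := sym hj
      have hc0 : compl D e j 0 = 0 := by
        unfold compl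
        have he : 0 < e := by
          by_contra he; push Not at he
          have : e = 0 := by omega
          subst this
          have := hj.zero 0 le_rfl; omega
        simp [he, hD]
      obtain ⟨i, hi, hne⟩ := uniq hp hW hF le_rfl hc (by omega) hc0
      refine ⟨j, hj, Or.inl ⟨compl D e i, ?_, ?_⟩⟩
      · have := sym hi
        have hx : M D p e - (M D p e - m) = m := by omega
        rwa [hx] at this
      · intro heq
        apply hne
        -- compl i = j ⇒ i = compl j
        have := congrArg (compl D e) heq
        rw [compl_compl hi] at this
        exact this
    · refine ⟨j, hj, Or.inr ⟨by omega, ?_⟩⟩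
      have := hj.le 0
      omega


/-! ## Part A: fillings of a capacity array (DIST, MULT, two fillings) -/


end Summit.ResolutionOfSingularities.KangarooAtlas.Mizutani.DigitLemma
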